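import Summits.QuantumFields.YangMills.Theorems.UnitScaleTiltFluctuationComparisonRegPrSmallBlocksSplit
import Summits.QuantumFields.YangMills.Theorems.UnitScaleTiltFluctuationComparisonRegPrPrintChi
import Literature.MathematicalPhysics.QuantumFieldTheory.Balaban1983to89.T3LogComparisonSocket
import HarnessLib

/-!
# `UnitScaleTiltFluctuationComparisonRegPrPrintChiSocket` — STUB 4′ of crux `FluctuationComparisonRegPrL` (stmt-QuantumFields-19935), repair (R1)
# «print's χ of [Balaban1985UV3] (47) back», part 2: the χ-RESTRICTED representation socket and the implication INTO the registered 4′ text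

Cell `ym3-torus`, width-lever lane `ym-ust-19935-r1`; sibling of `…PrintChi` (the predicate `ChiGood` = print's `χ_k` in the tree's currency, its
structural heredity and the transfer lemma).  Count-neutral helper (`--supports stmt-QuantumFields-19935`).  Pure bookkeeping; no estimate of
[Balaban1985UV3]/[King1986] is asserted.

* §4 `stubBodyOn_of_repOn_of_cauchy`: the χ-restricted representation `TwoSidedRepOn F γ b₀ p₀ S …` (sibling `…PrintChi` §4) ∧ `PintCauchyAt` ⇒ the 4′
  inequality a.e. on `Win ∩ S_K ∩ S_{K+1}` (the cell's `LogComparisonSocket.stubBody_of_rep_of_cauchy` with the predicate threaded through).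
* §5 `stub_logComparisonSmallBlocks_of_chi_edge` — THE REGISTERED 4′ TEXT, token for token, from (i) the comparison a.e. on the doubly-χ-good part of
  the window and (ii) the edge-oscillation clause off it (lane A's abstract glue `SmallBlocksSplit.aeBound_of_inner_of_edge`, p517185, at
  `I := Win ∧ χ_K ∧ χ_{K+1}`).  Versus the (R2′) split at `I := PlaqSmall (θBal/C_L)` (p517185 §2): no block-size constant `C_L`; the residual set
  `Win ∖ (χ_K ∩ χ_{K+1})` is the large-deviation set itself (isolated near-edge excitations are χ-good — lane A memo F-p2g13-1 §3.4), so (ii) is weaker.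
* §6 `stub_logComparisonSmallBlocks_of_repOnChi_edge` — 4′ from χ-restricted representation data (both runs, one `Pint E Rm`) with `PintCauchyAt`, and (ii):
  the (R1) line's composition, the inner piece in the currency the (α) lane delivers (no `7 ≤ L`: on χ-good data the fibre law's saddle point is
  inside every window with margin BY DEFINITION, `…PrintChi` §2).

WHAT THIS IS NOT: not a proof of 4′ — (ii) is located-unprinted new mathematics at `L = 3`; not a restatement of 4′ (the conclusions ARE the registered text).

References: T. Bałaban, CMP 102 (1985) 255–275 [Balaban1985UV3] ((41) p.266, (47) p.267); C. King, CMP 102 (1986) 649–677 [King1986] (Thm 3.4 (3.9) p.656,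
Props 3.8–3.9 pp.664–665).
-/

noncomputable section

namespace Summit.QuantumFields.YangMills.Theorems.PrintChi

open MeasureTheory Filter
open Literature.MathematicalPhysics.QuantumFieldTheory.Balaban1983to89
open Literature.MathematicalPhysics.QuantumFieldTheory.Balaban1983to89.T3ContinuumYM3Torus
open Literature.MathematicalPhysics.QuantumFieldTheory.Balaban1983to89.T3UnitLawDensityEML (ℰp measurableE_ℰp)
open Literature.MathematicalPhysics.QuantumFieldTheory.Balaban1983to89.T3UnitScaleTilt
open Literature.MathematicalPhysics.QuantumFieldTheory.Balaban1983to89.T3TiltDescent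
open Literature.MathematicalPhysics.QuantumFieldTheory.Balaban1983to89.T3PrintedRegularMinimiser
open Literature.MathematicalPhysics.QuantumFieldTheory.Balaban1983to89.T3LogComparisonSocket

/-! ## §4 The χ-restricted socket for one family -/

section Socket

/-- **THE RESTRICTED SOCKET FOR ONE FAMILY**: `TwoSidedRepOn S …` ∧ `PintCauchyAt …` (`m ≥ 1`) ⇒ the 4′ inequality a.e. on
`Win ∩ S_K ∩ S_{K+1}` (both densities positive), with `κ_K := c_K − E (K+1) n + E K n`, `r_K := Rm (K+1) n + Rm K n + r′_K`, `n = ⌊K/m⌋` — the cell's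
`LogComparisonSocket.stubBody_of_rep_of_cauchy` with the predicate threaded through. [cite: King1986, Thm 3.4 (3.9) p.656] -/
theorem stubBodyOn_of_repOn_of_cauchy (F : T3Family) (γ b₀ p₀ ε₀ : ℝ) {m : ℕ} (hm : 0 < m)
    (S : (K n : ℕ) → n ≤ K → GaugeField (F.P n) 0 (Matrix.specialUnitaryGroup (Fin 2) ℂ) → Prop)
    (Pint : (K n : ℕ) → GaugeField (F.P n) 0 (Matrix.specialUnitaryGroup (Fin 2) ℂ) → ℝ) (E Rm : ℕ → ℕ → ℝ)
    (hrep : TwoSidedRepOn F γ b₀ p₀ S ε₀ Pint E Rm) (hcauchy : PintCauchyAt F γ b₀ p₀ m Pint) :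
    ∃ (r κ : ℕ → ℝ), Summable r ∧ (∀ K, 0 ≤ r K) ∧
      ∀ K, ∀ᵐ V ∂fieldMeasure (F.P (K / m)) 0 (Matrix.specialUnitaryGroup (Fin 2) ℂ),
        PlaqSmall (θBal F.L γ b₀ p₀ (K / m)) V →
          S K (K / m) (Nat.div_le_self K m) V → S (K + 1) (K / m) ((Nat.div_le_self K m).trans (Nat.le_succ K)) V →
          0 < heightDensity F γ (Nat.div_le_self K m) (histGood F ℰp (θBal F.L γ b₀ p₀) K (K / m)) V →
          0 < heightDensity F γ ((Nat.div_le_self K m).trans (Nat.le_succ K))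
                (histGood F ℰp (θBal F.L γ b₀ p₀) (K + 1) (K / m)) V →
            |(Real.log (heightDensity F γ ((Nat.div_le_self K m).trans (Nat.le_succ K))
                  (histGood F ℰp (θBal F.L γ b₀ p₀) (K + 1) (K / m)) V) + bgRegPr' F γ m ε₀ K V) -
              (Real.log (heightDensity F γ (Nat.div_le_self K m) (histGood F ℰp (θBal F.L γ b₀ p₀) K (K / m)) V) + bgRegPr F γ m ε₀ K V) -
                κ K| ≤ r K := by
  obtain ⟨hRm0, hRsum, hR⟩ := hrep
  obtain ⟨r', c, hr', hr'0, hC⟩ := hcauchy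
  have hsum : Summable fun K : ℕ => Rm (K + 1) (K / m) + Rm K (K / m) + r' K := by
    have h := (hRsum m hm).add hr'
    refine h.congr fun K => ?_
    ring
  refine ⟨fun K => Rm (K + 1) (K / m) + Rm K (K / m) + r' K, fun K => c K - E (K + 1) (K / m) + E K (K / m),
    hsum, fun K => add_nonneg (add_nonneg (hRm0 _ _) (hRm0 _ _)) (hr'0 K), fun K => ?_⟩
  filter_upwards [hR K (K / m) (Nat.div_le_self K m), hR (K + 1) (K / m) ((Nat.div_le_self K m).trans (Nat.le_succ K)), hC K]
    with V hK hK1 hc hs hS hS' h0 h0'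
  have hy := hK hs hS h0
  have hx := hK1 hs hS' h0'
  have hPc := hc hs h0 h0'
  have key : ∀ x y P₀ P₁ E₀ E₁ c₀ : ℝ, x - y - (c₀ - E₁ + E₀) = (x - P₁ + E₁) - (y - P₀ + E₀) + (P₁ - P₀ - c₀) := by
    intros
    ring
  rw [bgRegPr'_eq, bgRegPr_eq, key _ _ (Pint K (K / m) V) (Pint (K + 1) (K / m) V) (E K (K / m)) (E (K + 1) (K / m)) (c K)]
  exact (abs_add_le _ _).trans (add_le_add ((abs_sub _ _).trans (add_le_add hx hy)) hPc)

end Socket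

/-! ## §5 The implication INTO the registered 4′ text -/

section Stub

/-- **STUB 4′ `stub_logComparisonSmallBlocks` FROM (i) THE COMPARISON ON THE χ-GOOD PART OF THE WINDOW AND (ii) THE EDGE-OSCILLATION CLAUSE OFF IT**
(repair (R1) typed; margin `μ L` per block size, e.g. `μ 3 = 1 − 2/√27` from §3).  (i) = the registered body asserted only at data that are χ-good for
BOTH runs (`ChiGood … K (K/m) V ∧ ChiGood … (K+1) (K/m) V`); (ii) = for every `K` a constant `c_K` with `|Δ_K − c_K| ≤ r′_K` a.e. on the window OFF
the doubly-χ-good set (both densities positive), `Σ r′ < ∞`, attained within `r′_K` on a non-null part of the doubly-χ-good set.  Both carry 4′'s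
quantifier prefix; the conclusion is 4′ token for token (lane A's abstract glue `SmallBlocksSplit.aeBound_of_inner_of_edge` at `I := Win ∧ χ ∧ χ′`).
Versus the (R2′) split (`I := PlaqSmall (θBal/C_L)`, p517185 §2): no block-size constant, and the residual set `Win ∖ (χ ∩ χ′)` is the
large-deviation set itself. [cite: King1986, Prop. 3.8-3.9 pp.664-665] -/
theorem stub_logComparisonSmallBlocks_of_chi_edge (μ : ℕ → ℝ)
    (hInner : ∀ (L : ℕ), Odd L → 1 < L → L < 7 → ∃ (b₁ p₁ : ℝ), ∀ (b₀ p₀ : ℝ), b₁ ≤ b₀ → p₁ ≤ p₀ → 0 < b₀ → 2 < p₀ →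
      ∃ ε₁ : ℝ, 0 < ε₁ ∧ ∀ (ε₀ : ℝ), 0 < ε₀ → ε₀ ≤ ε₁ → ∃ m₀ : ℕ, ∀ (m : ℕ), m₀ ≤ m →
        ∃ γ₁ : ℝ, 0 < γ₁ ∧ ∀ (F : T3Family) (γ : ℝ), F.L = L → 0 < γ → γ ≤ γ₁ →
          ∃ (r κ : ℕ → ℝ), Summable r ∧ (∀ K, 0 ≤ r K) ∧
            ∀ K, ∀ᵐ V ∂fieldMeasure (F.P (K / m)) 0 (Matrix.specialUnitaryGroup (Fin 2) ℂ),
              PlaqSmall (θBal F.L γ b₀ p₀ (K / m)) V →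
                ChiGood F γ b₀ p₀ ε₀ (μ L) (Nat.div_le_self K m) V →
                ChiGood F γ b₀ p₀ ε₀ (μ L) ((Nat.div_le_self K m).trans (Nat.le_succ K)) V →
                0 < heightDensity F γ (Nat.div_le_self K m) (histGood F ℰp (θBal F.L γ b₀ p₀) K (K / m)) V →
                0 < heightDensity F γ ((Nat.div_le_self K m).trans (Nat.le_succ K))
                      (histGood F ℰp (θBal F.L γ b₀ p₀) (K + 1) (K / m)) V →
                  |(Real.log (heightDensity F γ ((Nat.div_le_self K m).trans (Nat.le_succ K))
                        (histGood F ℰp (θBal F.L γ b₀ p₀) (K + 1) (K / m)) V) + bgRegPr' F γ m ε₀ K V) -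
                    (Real.log (heightDensity F γ (Nat.div_le_self K m) (histGood F ℰp (θBal F.L γ b₀ p₀) K (K / m)) V) + bgRegPr F γ m ε₀ K V) -
                      κ K| ≤ r K)
    (hEdge : ∀ (L : ℕ), Odd L → 1 < L → L < 7 → ∃ (b₁ p₁ : ℝ), ∀ (b₀ p₀ : ℝ), b₁ ≤ b₀ → p₁ ≤ p₀ → 0 < b₀ → 2 < p₀ →
      ∃ ε₁ : ℝ, 0 < ε₁ ∧ ∀ (ε₀ : ℝ), 0 < ε₀ → ε₀ ≤ ε₁ → ∃ m₀ : ℕ, ∀ (m : ℕ), m₀ ≤ m →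
        ∃ γ₁ : ℝ, 0 < γ₁ ∧ ∀ (F : T3Family) (γ : ℝ), F.L = L → 0 < γ → γ ≤ γ₁ →
          ∃ r' : ℕ → ℝ, Summable r' ∧ (∀ K, 0 ≤ r' K) ∧ ∀ K, ∃ c : ℝ,
            (∀ᵐ V ∂fieldMeasure (F.P (K / m)) 0 (Matrix.specialUnitaryGroup (Fin 2) ℂ),
              PlaqSmall (θBal F.L γ b₀ p₀ (K / m)) V →
                ¬ (ChiGood F γ b₀ p₀ ε₀ (μ L) (Nat.div_le_self K m) V ∧
                    ChiGood F γ b₀ p₀ ε₀ (μ L) ((Nat.div_le_self K m).trans (Nat.le_succ K)) V) →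
                0 < heightDensity F γ (Nat.div_le_self K m) (histGood F ℰp (θBal F.L γ b₀ p₀) K (K / m)) V →
                0 < heightDensity F γ ((Nat.div_le_self K m).trans (Nat.le_succ K))
                      (histGood F ℰp (θBal F.L γ b₀ p₀) (K + 1) (K / m)) V →
                  |(Real.log (heightDensity F γ ((Nat.div_le_self K m).trans (Nat.le_succ K))
                        (histGood F ℰp (θBal F.L γ b₀ p₀) (K + 1) (K / m)) V) + bgRegPr' F γ m ε₀ K V) -
                    (Real.log (heightDensity F γ (Nat.div_le_self K m) (histGood F ℰp (θBal F.L γ b₀ p₀) K (K / m)) V) + bgRegPr F γ m ε₀ K V) -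
                      c| ≤ r' K) ∧
            (∃ᵐ V ∂fieldMeasure (F.P (K / m)) 0 (Matrix.specialUnitaryGroup (Fin 2) ℂ),
              (PlaqSmall (θBal F.L γ b₀ p₀ (K / m)) V ∧
                ChiGood F γ b₀ p₀ ε₀ (μ L) (Nat.div_le_self K m) V ∧
                ChiGood F γ b₀ p₀ ε₀ (μ L) ((Nat.div_le_self K m).trans (Nat.le_succ K)) V) ∧
                0 < heightDensity F γ (Nat.div_le_self K m) (histGood F ℰp (θBal F.L γ b₀ p₀) K (K / m)) V ∧
                0 < heightDensity F γ ((Nat.div_le_self K m).trans (Nat.le_succ K))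
                      (histGood F ℰp (θBal F.L γ b₀ p₀) (K + 1) (K / m)) V ∧
                  |(Real.log (heightDensity F γ ((Nat.div_le_self K m).trans (Nat.le_succ K))
                        (histGood F ℰp (θBal F.L γ b₀ p₀) (K + 1) (K / m)) V) + bgRegPr' F γ m ε₀ K V) -
                    (Real.log (heightDensity F γ (Nat.div_le_self K m) (histGood F ℰp (θBal F.L γ b₀ p₀) K (K / m)) V) + bgRegPr F γ m ε₀ K V) -
                      c| ≤ r' K)) :
    ∀ (L : ℕ), Odd L → 1 < L → L < 7 → ∃ (b₁ p₁ : ℝ), ∀ (b₀ p₀ : ℝ), b₁ ≤ b₀ → p₁ ≤ p₀ → 0 < b₀ → 2 < p₀ →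
      ∃ ε₁ : ℝ, 0 < ε₁ ∧ ∀ (ε₀ : ℝ), 0 < ε₀ → ε₀ ≤ ε₁ → ∃ m₀ : ℕ, ∀ (m : ℕ), m₀ ≤ m →
        ∃ γ₁ : ℝ, 0 < γ₁ ∧ ∀ (F : T3Family) (γ : ℝ), F.L = L → 0 < γ → γ ≤ γ₁ →
          ∃ (r κ : ℕ → ℝ), Summable r ∧ (∀ K, 0 ≤ r K) ∧
            ∀ K, ∀ᵐ V ∂fieldMeasure (F.P (K / m)) 0 (Matrix.specialUnitaryGroup (Fin 2) ℂ),
              PlaqSmall (θBal F.L γ b₀ p₀ (K / m)) V →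
                0 < heightDensity F γ (Nat.div_le_self K m) (histGood F ℰp (θBal F.L γ b₀ p₀) K (K / m)) V →
                0 < heightDensity F γ ((Nat.div_le_self K m).trans (Nat.le_succ K))
                      (histGood F ℰp (θBal F.L γ b₀ p₀) (K + 1) (K / m)) V →
                  |(Real.log (heightDensity F γ ((Nat.div_le_self K m).trans (Nat.le_succ K))
                        (histGood F ℰp (θBal F.L γ b₀ p₀) (K + 1) (K / m)) V) + bgRegPr' F γ m ε₀ K V) -
                    (Real.log (heightDensity F γ (Nat.div_le_self K m) (histGood F ℰp (θBal F.L γ b₀ p₀) K (K / m)) V) + bgRegPr F γ m ε₀ K V) -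
                      κ K| ≤ r K := by
  intro L hLo hL hL7
  obtain ⟨b₁, p₁, H1⟩ := hInner L hLo hL hL7
  obtain ⟨b₁', p₁', H2⟩ := hEdge L hLo hL hL7
  refine ⟨max b₁ b₁', max p₁ p₁', fun b₀ p₀ hb hp hb₀ hp₀ => ?_⟩
  obtain ⟨ε₁, hε₁, H1'⟩ := H1 b₀ p₀ ((le_max_left _ _).trans hb) ((le_max_left _ _).trans hp) hb₀ hp₀
  obtain ⟨ε₁', hε₁', H2'⟩ := H2 b₀ p₀ ((le_max_right _ _).trans hb) ((le_max_right _ _).trans hp) hb₀ hp₀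
  refine ⟨min ε₁ ε₁', lt_min hε₁ hε₁', fun ε₀ hε₀ hε₀le => ?_⟩
  obtain ⟨m₀, Hm₁⟩ := H1' ε₀ hε₀ (hε₀le.trans (min_le_left _ _))
  obtain ⟨m₀', Hm₂⟩ := H2' ε₀ hε₀ (hε₀le.trans (min_le_right _ _))
  refine ⟨max m₀ m₀', fun m hm => ?_⟩
  obtain ⟨γ₁, hγ₁, HF₁⟩ := Hm₁ m ((le_max_left _ _).trans hm)
  obtain ⟨γ₁', hγ₁', HF₂⟩ := Hm₂ m ((le_max_right _ _).trans hm)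
  refine ⟨min γ₁ γ₁', lt_min hγ₁ hγ₁', fun F γ hFL hγ hγle => ?_⟩
  obtain ⟨r, κ, hr, hr0, hA⟩ := HF₁ F γ hFL hγ (hγle.trans (min_le_left _ _))
  obtain ⟨r', hr', hr'0, hB⟩ := HF₂ F γ hFL hγ (hγle.trans (min_le_right _ _))
  -- instantiate the abstract glue at `I := Win ∧ χ_K ∧ χ_{K+1}`
  have hglue := SmallBlocksSplit.aeBound_of_inner_of_edge
    (fun K => fieldMeasure (F.P (K / m)) 0 (Matrix.specialUnitaryGroup (Fin 2) ℂ))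
    (fun K V => PlaqSmall (θBal F.L γ b₀ p₀ (K / m)) V)
    (fun K V => PlaqSmall (θBal F.L γ b₀ p₀ (K / m)) V ∧
      ChiGood F γ b₀ p₀ ε₀ (μ L) (Nat.div_le_self K m) V ∧
      ChiGood F γ b₀ p₀ ε₀ (μ L) ((Nat.div_le_self K m).trans (Nat.le_succ K)) V)
    (fun K V => 0 < heightDensity F γ (Nat.div_le_self K m) (histGood F ℰp (θBal F.L γ b₀ p₀) K (K / m)) V)
    (fun K V => 0 < heightDensity F γ ((Nat.div_le_self K m).trans (Nat.le_succ K))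
      (histGood F ℰp (θBal F.L γ b₀ p₀) (K + 1) (K / m)) V)
    (fun K V => (Real.log (heightDensity F γ ((Nat.div_le_self K m).trans (Nat.le_succ K))
        (histGood F ℰp (θBal F.L γ b₀ p₀) (K + 1) (K / m)) V) + bgRegPr' F γ m ε₀ K V) -
      (Real.log (heightDensity F γ (Nat.div_le_self K m) (histGood F ℰp (θBal F.L γ b₀ p₀) K (K / m)) V) + bgRegPr F γ m ε₀ K V))
    ⟨r, κ, hr, hr0, fun K => by
      filter_upwards [hA K] with V hV
      rintro ⟨hs, hχ, hχ'⟩ h0 h0'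
      exact hV hs hχ hχ' h0 h0'⟩
    ⟨r', hr', hr'0, fun K => by
      obtain ⟨c, hc, hfreq⟩ := hB K
      refine ⟨c, ?_, hfreq⟩
      filter_upwards [hc] with V hV
      intro hs hnotI h0 h0'
      exact hV hs (fun hχχ => hnotI ⟨hs, hχχ.1, hχχ.2⟩) h0 h0'⟩
  obtain ⟨r'', κ'', hr'', hr''0, hC⟩ := hglue
  exact ⟨r'', κ'', hr'', hr''0, hC⟩

end Stub

/-! ## §6 The (R1) line's composition: 4′ from χ-restricted representation data, the Cauchy socket, and the edge clause -/

section Line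

/-- **STUB 4′ FROM χ-RESTRICTED REPRESENTATION DATA + THE CAUCHY SOCKET + THE EDGE CLAUSE** — the (R1) line's composition.  (i′) below the 4′
thresholds every family carries interaction data `Pint, E, Rm` with the two-sided representation ON THE χ-GOOD DATA of every run and height
(`TwoSidedRepOn … (ChiGood … (μ L)) …` — [Balaban1985UV3] (41) ∧ (47) as PRINTED, i.e. on `χ_k`; consistent at every block size since on χ-good data the
fibre law's saddle point sits inside every sharp window with margin, `…PrintChi` §2) together with the cut-off-Cauchy property `PintCauchyAt` of the
same data ([King1986] Thm 3.4 shape); (ii) the edge-oscillation clause off the doubly-χ-good set.  Conclusion: the registered 4′ text verbatim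
(§4 `stubBodyOn_of_repOn_of_cauchy` feeds §5 `stub_logComparisonSmallBlocks_of_chi_edge`; `m ≥ 1` is arranged inside). [cite: King1986, Thm 3.4 (3.9) p.656] -/
theorem stub_logComparisonSmallBlocks_of_repOnChi_edge (μ : ℕ → ℝ)
    (hRep : ∀ (L : ℕ), Odd L → 1 < L → L < 7 → ∃ (b₁ p₁ : ℝ), ∀ (b₀ p₀ : ℝ), b₁ ≤ b₀ → p₁ ≤ p₀ → 0 < b₀ → 2 < p₀ →
      ∃ ε₁ : ℝ, 0 < ε₁ ∧ ∀ (ε₀ : ℝ), 0 < ε₀ → ε₀ ≤ ε₁ → ∃ m₀ : ℕ, ∀ (m : ℕ), m₀ ≤ m →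
        ∃ γ₁ : ℝ, 0 < γ₁ ∧ ∀ (F : T3Family) (γ : ℝ), F.L = L → 0 < γ → γ ≤ γ₁ →
          ∃ (Pint : (K n : ℕ) → GaugeField (F.P n) 0 (Matrix.specialUnitaryGroup (Fin 2) ℂ) → ℝ) (E Rm : ℕ → ℕ → ℝ),
            TwoSidedRepOn F γ b₀ p₀ (fun K n h V => ChiGood F γ b₀ p₀ ε₀ (μ L) (n := n) (K := K) h V) ε₀ Pint E Rm ∧
              PintCauchyAt F γ b₀ p₀ m Pint)
    (hEdge : ∀ (L : ℕ), Odd L → 1 < L → L < 7 → ∃ (b₁ p₁ : ℝ), ∀ (b₀ p₀ : ℝ), b₁ ≤ b₀ → p₁ ≤ p₀ → 0 < b₀ → 2 < p₀ →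
      ∃ ε₁ : ℝ, 0 < ε₁ ∧ ∀ (ε₀ : ℝ), 0 < ε₀ → ε₀ ≤ ε₁ → ∃ m₀ : ℕ, ∀ (m : ℕ), m₀ ≤ m →
        ∃ γ₁ : ℝ, 0 < γ₁ ∧ ∀ (F : T3Family) (γ : ℝ), F.L = L → 0 < γ → γ ≤ γ₁ →
          ∃ r' : ℕ → ℝ, Summable r' ∧ (∀ K, 0 ≤ r' K) ∧ ∀ K, ∃ c : ℝ,
            (∀ᵐ V ∂fieldMeasure (F.P (K / m)) 0 (Matrix.specialUnitaryGroup (Fin 2) ℂ),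
              PlaqSmall (θBal F.L γ b₀ p₀ (K / m)) V →
                ¬ (ChiGood F γ b₀ p₀ ε₀ (μ L) (Nat.div_le_self K m) V ∧
                    ChiGood F γ b₀ p₀ ε₀ (μ L) ((Nat.div_le_self K m).trans (Nat.le_succ K)) V) →
                0 < heightDensity F γ (Nat.div_le_self K m) (histGood F ℰp (θBal F.L γ b₀ p₀) K (K / m)) V →
                0 < heightDensity F γ ((Nat.div_le_self K m).trans (Nat.le_succ K))
                      (histGood F ℰp (θBal F.L γ b₀ p₀) (K + 1) (K / m)) V →
                  |(Real.log (heightDensity F γ ((Nat.div_le_self K m).trans (Nat.le_succ K))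
                        (histGood F ℰp (θBal F.L γ b₀ p₀) (K + 1) (K / m)) V) + bgRegPr' F γ m ε₀ K V) -
                    (Real.log (heightDensity F γ (Nat.div_le_self K m) (histGood F ℰp (θBal F.L γ b₀ p₀) K (K / m)) V) + bgRegPr F γ m ε₀ K V) -
                      c| ≤ r' K) ∧
            (∃ᵐ V ∂fieldMeasure (F.P (K / m)) 0 (Matrix.specialUnitaryGroup (Fin 2) ℂ),
              (PlaqSmall (θBal F.L γ b₀ p₀ (K / m)) V ∧
                ChiGood F γ b₀ p₀ ε₀ (μ L) (Nat.div_le_self K m) V ∧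
                ChiGood F γ b₀ p₀ ε₀ (μ L) ((Nat.div_le_self K m).trans (Nat.le_succ K)) V) ∧
                0 < heightDensity F γ (Nat.div_le_self K m) (histGood F ℰp (θBal F.L γ b₀ p₀) K (K / m)) V ∧
                0 < heightDensity F γ ((Nat.div_le_self K m).trans (Nat.le_succ K))
                      (histGood F ℰp (θBal F.L γ b₀ p₀) (K + 1) (K / m)) V ∧
                  |(Real.log (heightDensity F γ ((Nat.div_le_self K m).trans (Nat.le_succ K))
                        (histGood F ℰp (θBal F.L γ b₀ p₀) (K + 1) (K / m)) V) + bgRegPr' F γ m ε₀ K V) -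
                    (Real.log (heightDensity F γ (Nat.div_le_self K m) (histGood F ℰp (θBal F.L γ b₀ p₀) K (K / m)) V) + bgRegPr F γ m ε₀ K V) -
                      c| ≤ r' K)) :
    ∀ (L : ℕ), Odd L → 1 < L → L < 7 → ∃ (b₁ p₁ : ℝ), ∀ (b₀ p₀ : ℝ), b₁ ≤ b₀ → p₁ ≤ p₀ → 0 < b₀ → 2 < p₀ →
      ∃ ε₁ : ℝ, 0 < ε₁ ∧ ∀ (ε₀ : ℝ), 0 < ε₀ → ε₀ ≤ ε₁ → ∃ m₀ : ℕ, ∀ (m : ℕ), m₀ ≤ m →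
        ∃ γ₁ : ℝ, 0 < γ₁ ∧ ∀ (F : T3Family) (γ : ℝ), F.L = L → 0 < γ → γ ≤ γ₁ →
          ∃ (r κ : ℕ → ℝ), Summable r ∧ (∀ K, 0 ≤ r K) ∧
            ∀ K, ∀ᵐ V ∂fieldMeasure (F.P (K / m)) 0 (Matrix.specialUnitaryGroup (Fin 2) ℂ),
              PlaqSmall (θBal F.L γ b₀ p₀ (K / m)) V →
                0 < heightDensity F γ (Nat.div_le_self K m) (histGood F ℰp (θBal F.L γ b₀ p₀) K (K / m)) V →
                0 < heightDensity F γ ((Nat.div_le_self K m).trans (Nat.le_succ K))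
                      (histGood F ℰp (θBal F.L γ b₀ p₀) (K + 1) (K / m)) V →
                  |(Real.log (heightDensity F γ ((Nat.div_le_self K m).trans (Nat.le_succ K))
                        (histGood F ℰp (θBal F.L γ b₀ p₀) (K + 1) (K / m)) V) + bgRegPr' F γ m ε₀ K V) -
                    (Real.log (heightDensity F γ (Nat.div_le_self K m) (histGood F ℰp (θBal F.L γ b₀ p₀) K (K / m)) V) + bgRegPr F γ m ε₀ K V) -
                      κ K| ≤ r K := by
  refine stub_logComparisonSmallBlocks_of_chi_edge μ (fun L hLo hL hL7 => ?_) hEdge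
  obtain ⟨b₁, p₁, H⟩ := hRep L hLo hL hL7
  refine ⟨b₁, p₁, fun b₀ p₀ hb hp hb₀ hp₀ => ?_⟩
  obtain ⟨ε₁, hε₁, H'⟩ := H b₀ p₀ hb hp hb₀ hp₀
  refine ⟨ε₁, hε₁, fun ε₀ hε₀ hε₀le => ?_⟩
  obtain ⟨m₀, Hm⟩ := H' ε₀ hε₀ hε₀le
  refine ⟨max m₀ 1, fun m hm => ?_⟩
  have hmpos : 0 < m := Nat.lt_of_lt_of_le Nat.one_pos ((le_max_right _ _).trans hm)
  obtain ⟨γ₁, hγ₁, HF⟩ := Hm m ((le_max_left _ _).trans hm)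
  refine ⟨γ₁, hγ₁, fun F γ hFL hγ hγle => ?_⟩
  obtain ⟨Pint, E, Rm, hrep, hcau⟩ := HF F γ hFL hγ hγle
  obtain ⟨r, κ, hr, hr0, hC⟩ := stubBodyOn_of_repOn_of_cauchy F γ b₀ p₀ ε₀ hmpos _ Pint E Rm hrep hcau
  refine ⟨r, κ, hr, hr0, fun K => ?_⟩
  filter_upwards [hC K] with V hV
  intro hs hχ hχ' h0 h0'
  exact hV hs hχ hχ' h0 h0'

end Line


end Summit.QuantumFields.YangMills.Theorems.PrintChi

end
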